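import Mathlib
import HarnessLib
import Literature.MathematicalPhysics.QuantumLattice.SectorisedEffectiveActionBoundDBPlateau
import Summits.HubbardSuperconductivity.HubbardSuperconductivity.Theorems.KLProgrammeKLRegimeEngineNormsStepDoor

/-!
# Route `KLProgramme` — ENGINE child stmt-HubbardSuperconductivity-20236 `KLRegimeEngineV16`, stub (b) `stub_engine_step_norms` at the
# inductive scales: the NORMS-STEP DOOR in DETERMINANT-BOUND currency (`IsGramBoundedR`)

Cell gate-hubbard-kl, seat hubbard-kl-r2d-p2 (g4); sequel of `…KLRegimeEngineNormsStepDoor` (`klNormsStep_of_sliceConsts`, explicit Gram form).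
The sector-propagator suppliers of the E1 lane (k3c2-p3: `gram_entry_klSliceCov_bgmFat_klEng`, …SectorSliceGramRegime p515376) deliver the Gram datum
of the sectorised slice `S(F̃)ᵀ·klSliceCov n′·S(F̃)` as a replica-stable determinant bound `IsGramBoundedR … κ` (de Siqueira Pedra–Salmhofer); the
door below takes exactly that hypothesis (via `Literature.…SectorisedEffectiveActionBoundDBPlateau`), everything else as in §2 of the predecessor:
input sizes `Nin` of `𝒱_{k+1}` in the thin family of index `k` (the private invariant P(k+1)), row/column sums `≤ α`, overlap `(cr, cc)` of
`E(klAnisoFamily j)·S(F̃_k)` for `j ≥ k+1`, radius `ρ`, `θ < 1`; output: `Z_{k+2} ≠ 0` and the BGM (2.77) bound on `𝒱_{k+2}` in the thin family `j`.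

* `klSliceCov_succ_succ_eq` — the slice of the step in the suppliers' `hubbardCovSliceCT … Λ Λ′` shape (`Λ = Λ_{k+2}`, `Λ′ = Λ_{k+1}`);
* **`klNormsStepDB_of_sliceConsts`**, `klAnisoLegKernelNorm_le_of_sliceConstsDB` (the public (E1-v4) left side at `k+2`).

Everything is proved; no definitions; nothing about the model is asserted beyond these implications.
-/

noncomputable section

namespace Summit.HubbardSuperconductivity.HubbardSuperconductivity.Theorems.EngineV8

set_option linter.dupNamespace false -- summit = problem name (single-conjunct summit), D-0017

open Real Finset Literature.MathematicalPhysics.QuantumLattice Literature.Probability.LatticeModels GrassmannAlgebra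
open Summit.HubbardSuperconductivity.HubbardSuperconductivity.Theorems.KLProgrammeLegKernels
open Summit.HubbardSuperconductivity.HubbardSuperconductivity.Theorems.KLRegimeSplit
open Summit.HubbardSuperconductivity.HubbardSuperconductivity.Theorems.KLRegimeWick
open Summit.HubbardSuperconductivity.HubbardSuperconductivity.Theorems.TwoPointAssembly

variable {L M : ℕ} [NeZero L]

/-! ## The door in determinant-bound currency

k3c2-p3's `isGramBoundedR_sliceCT_bgmFat` / …SectorSliceGram(Fat) bound the sectorised slice in the replica-stable Gram currency
`IsGramBoundedR (S(F̃)ᵀ·C^K_{(Λ,Λ′]}·S(F̃)) κ` (de Siqueira Pedra–Salmhofer); the door below takes exactly that hypothesis in place of the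
explicit Gram form `(q, fv, gv)` of §2 (`Literature.…SectorisedEffectiveActionBoundDBPlateau`).  `klSliceCov_succ_succ_eq` rewrites the slice
of the step into the suppliers' `hubbardCovSliceCT … Λ Λ′` shape (`Λ = Λ_{k+2}`, `Λ′ = Λ_{k+1}`). -/

section DoorDB

variable [NeZero M]

omit [NeZero L] [NeZero M] in
/-- The slice of the step `k+1 ↦ k+2` in the suppliers' shape: `klSliceCov (k+2) = C^K_{(Λ_{k+2}, Λ_{k+1}]}`. -/
theorem klSliceCov_succ_succ_eq (β μ : ℝ) (K : TrigPolyC4v) (k : ℕ) :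
    klSliceCov L M β μ K (k + 2) = hubbardCovSliceCT L M β μ 0 K (klScale klE0 (k + 2)) (klScale klE0 (k + 1)) := by
  rw [klSliceCov, show k + 2 - 1 = k + 1 by omega]

/-- **`klNormsStepDB_of_sliceConsts` — the n ≥ 1 NORMS-STEP DOOR of `stub_engine_step_norms`, determinant-bound currency** (step
`k+1 ↦ k+2`).  As `klNormsStep_of_sliceConsts`, with the Gram datum of the sectorised slice `S(F̃_k)ᵀ·klSliceCov (k+2)·S(F̃_k)` given as
`IsGramBoundedR … κ` (the output of `isGramBoundedR_sliceCT_bgmFat`-type suppliers, via `klSliceCov_succ_succ_eq`).  Conclusion: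
`Z_{k+2} ≠ 0` and, for every degree `m+1` and constraint set `A`,
`‖𝒱_{k+2}‖_{klAnisoFamily j, A, m+1} ≤ cr·cc^m·ε^m·ρ^{-(m+1)}·e·normV κ ρ Nin/(1−θ)` (`j ≥ k+1`). -/
theorem klNormsStepDB_of_sliceConsts
    {β : ℝ} (hβ : 0 < β) (U μ : ℝ) (K : TrigPolyC4v) (k : ℕ)
    (hZ : klStepPartitionFn L M β U μ K (k + 1) ≠ 0)
    (Nin : ℕ → ℝ)
    (hNin : ∀ m' : ℕ, imagTimeWeight β M *
      hubbardSectorKernelNorm L M β (klAnisoFamily L M β μ K klE0 k) (univ : Finset (Fin (2 * m') → SectorLeg (sectorCount k)))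
        (klEffectiveAction L M β U μ K klE0 (k + 1)) ≤ Nin m')
    {κ : ℝ} (hκ : 0 < κ)
    (hGB : IsGramBoundedR ((sectorSubMatrix L M β (bgmFatMultiplier L M klE0 β (nambuXiCT L μ K) k)).transpose *
      klSliceCov L M β μ K (k + 2) * sectorSubMatrix L M β (bgmFatMultiplier L M klE0 β (nambuXiCT L μ K) k)) κ)
    {α : ℝ} (hα : 0 < α)
    (hrow : ∀ X, ∑ Y, ‖((sectorSubMatrix L M β (bgmFatMultiplier L M klE0 β (nambuXiCT L μ K) k)).transpose *
      klSliceCov L M β μ K (k + 2) * sectorSubMatrix L M β (bgmFatMultiplier L M klE0 β (nambuXiCT L μ K) k)) X Y‖ ≤ α)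
    (hcol : ∀ Y, ∑ X, ‖((sectorSubMatrix L M β (bgmFatMultiplier L M klE0 β (nambuXiCT L μ K) k)).transpose *
      klSliceCov L M β μ K (k + 2) * sectorSubMatrix L M β (bgmFatMultiplier L M klE0 β (nambuXiCT L μ K) k)) X Y‖ ≤ α)
    {ρ : ℝ} (hρ : 0 < ρ)
    (hθ : Real.exp 1 * α * normV (SpaceTimeIdx L M × SectorLeg (sectorCount k)) κ ρ Nin / κ ^ 2 < 1)
    {j : ℕ} (hj : k + 1 ≤ j) {cr cc : ℝ} (hcr0 : 0 ≤ cr) (hcc0 : 0 ≤ cc)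
    (hrow' : ∀ X'', ∑ X', ‖(sectorAnalysisMatrix L M β (klAnisoFamily L M β μ K klE0 j) *
      sectorSubMatrix L M β (bgmFatMultiplier L M klE0 β (nambuXiCT L μ K) k)) X'' X'‖ ≤ cr)
    (hcol' : ∀ X', ∑ X'', ‖(sectorAnalysisMatrix L M β (klAnisoFamily L M β μ K klE0 j) *
      sectorSubMatrix L M β (bgmFatMultiplier L M klE0 β (nambuXiCT L μ K) k)) X'' X'‖ ≤ cc)
    (m : ℕ) (A : Finset (Fin (m + 1) → SectorLeg (sectorCount j))) :
    klStepPartitionFn L M β U μ K (k + 2) ≠ 0 ∧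
      hubbardSectorKernelNorm L M β (klAnisoFamily L M β μ K klE0 j) A (klEffectiveAction L M β U μ K klE0 (k + 2)) ≤
        cr * cc ^ m * imagTimeWeight β M ^ m * (ρ⁻¹ ^ (m + 1) *
          (Real.exp 1 * normV (SpaceTimeIdx L M × SectorLeg (sectorCount k)) κ ρ Nin) /
            (1 - Real.exp 1 * α * normV (SpaceTimeIdx L M × SectorLeg (sectorCount k)) κ ρ Nin / κ ^ 2)) := by
  have he : (0 : ℝ) < klE0 := by norm_num [klE0]
  -- notation
  set F : Fin (sectorCount k) → FreqMomentum L M → ℂ := klAnisoFamily L M β μ K klE0 k with hF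
  set Ft : Fin (sectorCount k) → FreqMomentum L M → ℂ := bgmFatMultiplier L M klE0 β (nambuXiCT L μ K) k with hFt
  set F' : Fin (sectorCount j) → FreqMomentum L M → ℂ := klAnisoFamily L M β μ K klE0 j with hF'
  set G : HubbardGrassmann L M := klEffectiveAction L M β U μ K klE0 (k + 1) with hG
  set C : Matrix (HubbardFieldIdx L M) (HubbardFieldIdx L M) ℂ := klSliceCov L M β μ K (k + 2) with hCdef
  -- the exact norms of the input and their majorant
  set Nex : ℕ → ℝ := fun m' => imagTimeWeight β M *
    hubbardSectorKernelNorm L M β F (univ : Finset (Fin (2 * m') → SectorLeg (sectorCount k))) G with hNex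
  set nV : ℝ := normV (SpaceTimeIdx L M × SectorLeg (sectorCount k)) κ ρ Nex with hnV
  set nVin : ℝ := normV (SpaceTimeIdx L M × SectorLeg (sectorCount k)) κ ρ Nin with hnVin
  have hle : nV ≤ nVin := normV_mono hκ.le hρ.le fun m' => hNin m'
  have hnV0 : 0 ≤ nV := normV_nonneg hκ.le hρ.le fun m' =>
    mul_nonneg (imagTimeWeight_nonneg hβ.le M) (hubbardSectorKernelNorm_nonneg hβ.le F univ G)
  have hθ' : Real.exp 1 * α * nV / κ ^ 2 < 1 := lt_of_le_of_lt (by gcongr) hθ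
  -- the hypotheses of the plateau step
  have hFF : ∀ ω p, Ft ω p * F ω p = F ω p := fun ω p => bgmFatMultiplier_mul_bgmMultiplier he β (nambuXiCT L μ K) k ω p
  have hF0 : ∀ p, ∑ ω, F ω p = 0 → ∀ ω, F ω p = 0 := fun p hp ω => klAnisoFamily_eq_zero_of_sum_eq_zero β μ K klE0 k p hp ω
  have hGe : G ∈ evenPart ℂ (HubbardFieldIdx L M) := mem_evenPart_iff.2 (klw_effectiveAction_mem_evenOdd_zero L M β U μ K (k + 1))
  have hG0 : constPart ℂ G = 0 := constPart_hubbardEffectiveActionCT L M β U μ 0 K hZ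
  have hCpl : ∀ X Y, C X Y ≠ 0 → ∑ ω, F ω X.1.1 = 1 ∧ ∑ ω, F ω Y.1.1 = 1 :=
    fun X Y h => sum_klAnisoFamily_eq_one_of_klSliceCov_ne_zero β μ K k X Y h
  have hF'pl : ∀ (ω' : Fin (sectorCount j)) (p : FreqMomentum L M), F' ω' p ≠ 0 → ∑ ω, F ω p = 1 :=
    fun ω' p h => sum_klAnisoFamily_eq_one_of_klAnisoFamily_ne_zero β μ K hj ω' p h
  -- the plateau step, determinant-bound currency
  obtain ⟨hunit, hbd⟩ := hubbardSectorKernelNorm_effAction_le_of_sectorNorm_of_gramBounded_of_plateau hβ F Ft hFF hF0 F' G hGe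
    hG0 C hCpl hF'pl hκ hGB hα hrow hcol hρ hθ' hcr0 hcc0 hrow' hcol' m A
  -- the step identity and the partition functions
  have hstep : klEffectiveAction L M β U μ K klE0 (k + 2) = effAction ℂ C G := klw_effectiveAction_succ L M β U μ K (k + 1) hZ
  refine ⟨?_, ?_⟩
  · have hZ' : klStepPartitionFn L M β U μ K (k + 2) =
        klStepPartitionFn L M β U μ K (k + 1) * effPartitionFn ℂ C G := by
      have hcov : klHardCov L M β μ K (k + 2) = C + klHardCov L M β μ K (k + 1) := klw_hardCov_succ L M β μ K (k + 1)
      have hu : IsUnit (effPartitionFn ℂ (klHardCov L M β μ K (k + 1)) (hubbardInteractionCT L M β U K)) :=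
        isUnit_iff_ne_zero.2 hZ
      show effPartitionFn ℂ (klHardCov L M β μ K (k + 2)) (hubbardInteractionCT L M β U K) =
        effPartitionFn ℂ (klHardCov L M β μ K (k + 1)) (hubbardInteractionCT L M β U K) * effPartitionFn ℂ C G
      rw [hcov, effPartitionFn_add_of_isUnit _ _ _ hu]
      rfl
    rw [hZ']
    exact mul_ne_zero hZ hunit.ne_zero
  · rw [hstep]
    refine hbd.trans ?_
    have hB := step_bound_mono hκ hα hnV0 hle hθ
    have hε : 0 ≤ imagTimeWeight β M := imagTimeWeight_nonneg hβ.le M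
    calc cr * cc ^ m * imagTimeWeight β M ^ m * (ρ⁻¹ ^ (m + 1) * (Real.exp 1 * nV) / (1 - Real.exp 1 * α * nV / κ ^ 2))
        = cr * cc ^ m * imagTimeWeight β M ^ m * ρ⁻¹ ^ (m + 1) * (Real.exp 1 * nV / (1 - Real.exp 1 * α * nV / κ ^ 2)) := by
          ring
      _ ≤ cr * cc ^ m * imagTimeWeight β M ^ m * ρ⁻¹ ^ (m + 1) *
            (Real.exp 1 * nVin / (1 - Real.exp 1 * α * nVin / κ ^ 2)) :=
          mul_le_mul_of_nonneg_left hB (by positivity)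
      _ = _ := by ring

/-- **The public (E1-v4) left-hand side at the next scale, determinant-bound currency**: `klAnisoLegKernelNorm … (k+2) (m+1)` from
the `IsGramBoundedR` datum (reading `j = k+2`, `A = bgmSectorSet` of `klNormsStepDB_of_sliceConsts`). -/
theorem klAnisoLegKernelNorm_le_of_sliceConstsDB
    {β : ℝ} (hβ : 0 < β) (U μ : ℝ) (K : TrigPolyC4v) (k : ℕ)
    (hZ : klStepPartitionFn L M β U μ K (k + 1) ≠ 0)
    (Nin : ℕ → ℝ)
    (hNin : ∀ m' : ℕ, imagTimeWeight β M *
      hubbardSectorKernelNorm L M β (klAnisoFamily L M β μ K klE0 k) (univ : Finset (Fin (2 * m') → SectorLeg (sectorCount k)))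
        (klEffectiveAction L M β U μ K klE0 (k + 1)) ≤ Nin m')
    {κ : ℝ} (hκ : 0 < κ)
    (hGB : IsGramBoundedR ((sectorSubMatrix L M β (bgmFatMultiplier L M klE0 β (nambuXiCT L μ K) k)).transpose *
      klSliceCov L M β μ K (k + 2) * sectorSubMatrix L M β (bgmFatMultiplier L M klE0 β (nambuXiCT L μ K) k)) κ)
    {α : ℝ} (hα : 0 < α)
    (hrow : ∀ X, ∑ Y, ‖((sectorSubMatrix L M β (bgmFatMultiplier L M klE0 β (nambuXiCT L μ K) k)).transpose *
      klSliceCov L M β μ K (k + 2) * sectorSubMatrix L M β (bgmFatMultiplier L M klE0 β (nambuXiCT L μ K) k)) X Y‖ ≤ α)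
    (hcol : ∀ Y, ∑ X, ‖((sectorSubMatrix L M β (bgmFatMultiplier L M klE0 β (nambuXiCT L μ K) k)).transpose *
      klSliceCov L M β μ K (k + 2) * sectorSubMatrix L M β (bgmFatMultiplier L M klE0 β (nambuXiCT L μ K) k)) X Y‖ ≤ α)
    {ρ : ℝ} (hρ : 0 < ρ)
    (hθ : Real.exp 1 * α * normV (SpaceTimeIdx L M × SectorLeg (sectorCount k)) κ ρ Nin / κ ^ 2 < 1)
    {cr cc : ℝ} (hcr0 : 0 ≤ cr) (hcc0 : 0 ≤ cc)
    (hrow' : ∀ X'', ∑ X', ‖(sectorAnalysisMatrix L M β (klAnisoFamily L M β μ K klE0 (k + 2)) *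
      sectorSubMatrix L M β (bgmFatMultiplier L M klE0 β (nambuXiCT L μ K) k)) X'' X'‖ ≤ cr)
    (hcol' : ∀ X', ∑ X'', ‖(sectorAnalysisMatrix L M β (klAnisoFamily L M β μ K klE0 (k + 2)) *
      sectorSubMatrix L M β (bgmFatMultiplier L M klE0 β (nambuXiCT L μ K) k)) X'' X'‖ ≤ cc)
    (m : ℕ) :
    klAnisoLegKernelNorm L M β U μ K klE0 (k + 2) (m + 1) ≤
      cr * cc ^ m * imagTimeWeight β M ^ m * (ρ⁻¹ ^ (m + 1) *
        (Real.exp 1 * normV (SpaceTimeIdx L M × SectorLeg (sectorCount k)) κ ρ Nin) /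
          (1 - Real.exp 1 * α * normV (SpaceTimeIdx L M × SectorLeg (sectorCount k)) κ ρ Nin / κ ^ 2)) :=
  (klNormsStepDB_of_sliceConsts hβ U μ K k hZ Nin hNin hκ hGB hα hrow hcol hρ hθ (by omega) hcr0 hcc0 hrow' hcol' m _).2

end DoorDB

end Summit.HubbardSuperconductivity.HubbardSuperconductivity.Theorems.EngineV8

end
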